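import Summits.AtomisticToContinuum.Crystallization.Theorems.FrustratedLawDichotomyStrainedPatchHomSplitNarrowRoot
import Summits.AtomisticToContinuum.Crystallization.Theorems.FrustratedLawDichotomyStrainedPatchHomEntrySemanticQuot

/-!
# `(H_W) HomFloorW ρ_U ρ_ξ m` — the hcp half over the `D₃ₕ` quotient at radii `(ρ_U, ρ_ξ)`, and `(H_W)` from ONE `semOKHQ` fact on a narrow root box

decomp-a2c hand-1 g45 (crux `AperiodicFrustratedLawGap`, stmt-AtomisticToContinuum-27623; `(H) HomFloor`, hcp half; sequel of `…StrainedPatchHomSplitNarrowRoot`).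
The record hcp root `…EntrySemanticQuot.hcpHalf_of_semOKHQ` / `homFloor_of_entryTree6RBKP4_semOKHQ` chains the `D₃ₕ` fundamental-domain reduction
`hcpHalf_of_sector` / `hcpHalf_of_quotU` (typed at `‖U − 1‖ ≤ 1/4`, `‖ξ‖ ≤ 1/4`) with ONE semantic fact `semOKHQ μ rootCHQ rootWHQ` on the quarter root box.
The reduction is radius-agnostic (conjugation by a linear isometry preserves `‖U − 1‖`, `conjIso_norm_sub_one_le`; isometries preserve `‖ξ‖`), and every
`semOKHQ` fact is usable at narrower radii (its hypotheses `≤ 1/4` are implied).  This DEF-FREE file threads radii `ρ_U, ρ_ξ ≤ 1/4`: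

* §1 `conj_data_rad`, `norm_iso_le_rad` (the two transport facts at any radius); ★ `hcpHalfW_of_sector`, ★ `hcpHalfW_of_quotU` (×3 / ×12 reductions at radii);
* §2 ★★ `hcpDichW_of_semOKHQ_box` — the narrow hcp half from ONE `semOKHQ μ cR wR` fact on ANY integer box `(cR, wR)` that contains the narrow fundamental
  domain (containment as a real-side hypothesis, so the literal narrow root boxes — definitions, a later reviewed file — plug in by one lemma each);
  `hcpDichW_of_semOKHQ_rootQ` (the record quarter root box serves every narrow family);
* §3 ★★★ `homFloorW_of_fccPruned_of_hcpDichW` and `homFloorW_of_fccPruned_semOKHQ_box` — `(H_W)` from the narrow fcc pruned-box-sum hypothesis over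
  self-adjoint `U` and the narrow hcp half / one `semOKHQ` fact (via `homFloorW_of_prunedBoxSums_selfAdjoint`).

Record proofs with the radii threaded; nothing landed is modified.  0 sorry; no definitions; standard axioms; no instances / notation / `#eval`.
`--supports stmt-AtomisticToContinuum-27623`.
-/

noncomputable section

namespace Summit.AtomisticToContinuum.Crystallization.Theorems.FrustratedLawDichotomyStrainedPatchHomSplitNarrow

open scoped BigOperators Classical RealInnerProductSpace
open Literature.Analysis.ValidatedNumerics.Numerics
open Summit.AtomisticToContinuum.Crystallization.Theorems.ChargedEnergyGapNegative (E3)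
open Summit.AtomisticToContinuum.Crystallization.Theorems.FrustratedLawDichotomySchurCut (effPot w₄₅ ω₄)
open Summit.AtomisticToContinuum.Crystallization.Theorems.FrustratedLawDichotomyAveragingRuleTightFree (TightNearCap BadNearCap)
open Summit.AtomisticToContinuum.Crystallization.Theorems.FrustratedLawDichotomyExemptAbsorption (ExemptNear)
open Summit.AtomisticToContinuum.Crystallization.Theorems.FrustratedLawDichotomyStrainedPatchHomSplit
open Summit.AtomisticToContinuum.Crystallization.Theorems.FrustratedLawDichotomyStrainedPatchHomEntrySignKit (flipIso flipIso_apply flip_entry conjIso_selfAdjoint conjIso_pos conjIso_norm_sub_one_le)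
open Summit.AtomisticToContinuum.Crystallization.Theorems.FrustratedLawDichotomyStrainedPatchHomEntryFlipHcp (HcpDich hcpDich_of_flip)
open Summit.AtomisticToContinuum.Crystallization.Theorems.FrustratedLawDichotomyStrainedPatchHomEntryMirrorHcpKit (mirIso mirIso_apply)
open Summit.AtomisticToContinuum.Crystallization.Theorems.FrustratedLawDichotomyStrainedPatchHomEntryMirrorHcp (hcpDich_of_mir)
open Summit.AtomisticToContinuum.Crystallization.Theorems.FrustratedLawDichotomyStrainedPatchHomEntryLeafHT (hcpCoord HcpLeafGoal)
open Summit.AtomisticToContinuum.Crystallization.Theorems.FrustratedLawDichotomyStrainedPatchHomEntrySemanticQuot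
open Literature.Barriers.AtomisticToContinuum.FlatleyTheil2015 (fccVec)

/-! ## §1. The `D₃ₕ` reduction at radii `(ρ_U, ρ_ξ)` -/

/-- Conjugating a self-adjoint positive `V` with `‖V − 1‖ ≤ ρ` by a linear isometry gives a self-adjoint positive operator with `‖· − 1‖ ≤ ρ`
(record `conj_data` is `ρ = 1/4`). [formal bookkeeping] -/
theorem conj_data_rad (P : E3 ≃ₗᵢ[ℝ] E3) {ρ : ℝ} {V : E3 →L[ℝ] E3} (hVsa : ∀ v w : E3, inner ℝ (V v) w = inner ℝ v (V w))
    (hVpos : ∀ w : E3, 0 ≤ inner ℝ w (V w)) (hV : ‖V - 1‖ ≤ ρ) :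
    (∀ v w : E3, inner ℝ (((P : E3 →L[ℝ] E3).comp (V.comp (P.symm : E3 →L[ℝ] E3))) v) w =
        inner ℝ v (((P : E3 →L[ℝ] E3).comp (V.comp (P.symm : E3 →L[ℝ] E3))) w)) ∧
      (∀ w : E3, 0 ≤ inner ℝ w (((P : E3 →L[ℝ] E3).comp (V.comp (P.symm : E3 →L[ℝ] E3))) w)) ∧
      ‖(P : E3 →L[ℝ] E3).comp (V.comp (P.symm : E3 →L[ℝ] E3)) - 1‖ ≤ ρ :=
  ⟨conjIso_selfAdjoint P hVsa, conjIso_pos P hVpos, (conjIso_norm_sub_one_le P V).trans hV⟩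

/-- A linear isometry preserves `‖η‖ ≤ ρ` (record `norm_iso_le` is `ρ = 1/4`). [formal bookkeeping] -/
theorem norm_iso_le_rad (P : E3 ≃ₗᵢ[ℝ] E3) {ρ : ℝ} {η : E3} (hη : ‖η‖ ≤ ρ) : ‖P η‖ ≤ ρ := by rwa [LinearIsometryEquiv.norm_map]

/-- ★ **REDUCTION TO THE SECTOR `Σ` at radii `(ρ_U, ρ_ξ)`** (×3; record `hcpHalf_of_sector`). [folklore] -/
theorem hcpHalfW_of_sector {ρU ρξ m : ℝ} (hρU : ρU ≤ 1 / 4) (hρξ : ρξ ≤ 1 / 4)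
    (h : ∀ (U : E3 →L[ℝ] E3) (ξ : E3), (∀ v w : E3, inner ℝ (U v) w = inner ℝ v (U w)) → (∀ w : E3, 0 ≤ inner ℝ w (U w)) →
      ‖U - 1‖ ≤ ρU → ‖ξ‖ ≤ ρξ → ξ 1 ≤ 0 → (ξ 0) ^ 2 ≤ 3 * (ξ 1) ^ 2 → HcpDich m U ξ) :
    ∀ (U : E3 →L[ℝ] E3) (ξ : E3), (∀ v w : E3, inner ℝ (U v) w = inner ℝ v (U w)) → (∀ w : E3, 0 ≤ inner ℝ w (U w)) →
      ‖U - 1‖ ≤ ρU → ‖ξ‖ ≤ ρξ → HcpDich m U ξ := by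
  intro U ξ hsa hpos hU hξ
  have hU4 : ‖U - 1‖ ≤ 1 / 4 := hU.trans hρU
  have hξ4 : ‖ξ‖ ≤ 1 / 4 := hξ.trans hρξ
  rcases sector_trichotomy (ξ 0) (ξ 1) with ⟨hb, hab⟩ | ⟨hb, hab⟩ | ⟨hb, hab⟩
  · exact h U ξ hsa hpos hU hξ hb hab
  · -- `F₀ S`
    obtain ⟨s1, p1, n1⟩ := conj_data_rad mirIso hsa hpos hU
    obtain ⟨s2, p2, n2⟩ := conj_data_rad (flipIso 0) s1 p1 n1
    have hξ1 := norm_iso_le_rad mirIso hξ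
    have hξ2 := norm_iso_le_rad (flipIso 0) hξ1
    obtain ⟨m0, m1, -⟩ := mirIso_apply ξ
    obtain ⟨a0, a1, -⟩ := flip0_coords (mirIso ξ)
    refine hcpDich_of_mir U ξ hU4 hξ4 (hcpDich_of_flip (Or.inl rfl) _ _ (n1.trans hρU) (hξ1.trans hρξ) (h _ _ s2 p2 n2 hξ2 ?_ ?_))
    · rw [a1, m1]; exact hb
    · rw [a0, a1, m0, m1]; exact hab
  · -- `S F₀`
    obtain ⟨s1, p1, n1⟩ := conj_data_rad (flipIso 0) hsa hpos hU
    obtain ⟨s2, p2, n2⟩ := conj_data_rad mirIso s1 p1 n1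
    have hξ1 := norm_iso_le_rad (flipIso 0) hξ
    have hξ2 := norm_iso_le_rad mirIso hξ1
    obtain ⟨a0, a1, -⟩ := flip0_coords ξ
    obtain ⟨m0, m1, -⟩ := mirIso_apply (flipIso 0 ξ)
    refine hcpDich_of_flip (Or.inl rfl) U ξ hU4 hξ4 (hcpDich_of_mir _ _ (n1.trans hρU) (hξ1.trans hρξ) (h _ _ s2 p2 n2 hξ2 ?_ ?_))
    · rw [m1, a0, a1]; exact hb
    · rw [m0, m1, a0, a1]; exact hab

/-- ★ **REDUCTION TO THE FULL FUNDAMENTAL DOMAIN at radii `(ρ_U, ρ_ξ)`** (×12: the sector `Σ` in `ξ`, the reflections as the entry walls `0 ≤ u₀₁`,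
`u₁₂ ≤ 0`; record `hcpHalf_of_quotU`). [folklore] -/
theorem hcpHalfW_of_quotU {ρU ρξ m : ℝ} (hρU : ρU ≤ 1 / 4) (hρξ : ρξ ≤ 1 / 4)
    (h : ∀ (U : E3 →L[ℝ] E3) (ξ : E3), (∀ v w : E3, inner ℝ (U v) w = inner ℝ v (U w)) → (∀ w : E3, 0 ≤ inner ℝ w (U w)) →
      ‖U - 1‖ ≤ ρU → ‖ξ‖ ≤ ρξ → 0 ≤ (U (EuclideanSpace.single 1 (1 : ℝ))) 0 → (U (EuclideanSpace.single 2 (1 : ℝ))) 1 ≤ 0 →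
      ξ 1 ≤ 0 → (ξ 0) ^ 2 ≤ 3 * (ξ 1) ^ 2 → HcpDich m U ξ) :
    ∀ (U : E3 →L[ℝ] E3) (ξ : E3), (∀ v w : E3, inner ℝ (U v) w = inner ℝ v (U w)) → (∀ w : E3, 0 ≤ inner ℝ w (U w)) →
      ‖U - 1‖ ≤ ρU → ‖ξ‖ ≤ ρξ → HcpDich m U ξ := by
  refine hcpHalfW_of_sector hρU hρξ fun U ξ hsa hpos hU hξ hb hab => ?_
  -- step `F₂`: reduce to `u₁₂ ≤ 0` given `u₀₁ ≥ 0`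
  have step : ∀ (V : E3 →L[ℝ] E3) (η : E3), (∀ v w : E3, inner ℝ (V v) w = inner ℝ v (V w)) → (∀ w : E3, 0 ≤ inner ℝ w (V w)) →
      ‖V - 1‖ ≤ ρU → ‖η‖ ≤ ρξ → η 1 ≤ 0 → (η 0) ^ 2 ≤ 3 * (η 1) ^ 2 → 0 ≤ (V (EuclideanSpace.single 1 (1 : ℝ))) 0 → HcpDich m V η := by
    intro V η hVsa hVpos hV hη hb' hab' h01
    by_cases h12 : (V (EuclideanSpace.single 2 (1 : ℝ))) 1 ≤ 0
    · exact h V η hVsa hVpos hV hη h01 h12 hb' hab'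
    · obtain ⟨s1, p1, n1⟩ := conj_data_rad (flipIso 2) hVsa hVpos hV
      obtain ⟨-, -, e01, e12⟩ := flip_wall_entries V
      obtain ⟨c0, c1, -⟩ := flip2_coords η
      refine hcpDich_of_flip (Or.inr rfl) V η (hV.trans hρU) (hη.trans hρξ) (h _ _ s1 p1 n1 (norm_iso_le_rad (flipIso 2) hη) ?_ ?_ ?_ ?_)
      · rw [e01]; exact h01
      · rw [e12]; linarith [lt_of_not_ge h12]
      · rw [c1]; exact hb'
      · rw [c0, c1]; exact hab'
  by_cases h01 : 0 ≤ (U (EuclideanSpace.single 1 (1 : ℝ))) 0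
  · exact step U ξ hsa hpos hU hξ hb hab h01
  · obtain ⟨s1, p1, n1⟩ := conj_data_rad (flipIso 0) hsa hpos hU
    obtain ⟨e01, -, -, -⟩ := flip_wall_entries U
    obtain ⟨c0, c1, -⟩ := flip0_coords ξ
    refine hcpDich_of_flip (Or.inl rfl) U ξ (hU.trans hρU) (hξ.trans hρξ) (step _ _ s1 p1 n1 (norm_iso_le_rad (flipIso 0) hξ) ?_ ?_ ?_)
    · rw [c1]; exact hb
    · rw [c0, c1, neg_sq]; exact hab
    · rw [e01]; linarith [lt_of_not_ge h01]

/-! ## §2. The narrow hcp half from ONE `semOKHQ` fact on a box containing the narrow fundamental domain -/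

/-- ★★ **NARROW hcp HALF FROM ONE SEMANTIC FACT**: if an integer box `(cR, wR)` contains the hcp coordinates of every self-adjoint positive `U` with
`‖U − 1‖ ≤ ρ_U` and walls `0 ≤ u₀₁`, `u₁₂ ≤ 0`, and every `ξ` with `‖ξ‖ ≤ ρ_ξ`, then `semOKHQ μ cR wR = true` at any `μ` with `2 (m + e_W) SC ≤ μ` gives the
hcp dichotomy at floor `m` on the whole `(ρ_U, ρ_ξ)` family (`ρ_U, ρ_ξ ≤ 1/4`).  The containment is a real-side hypothesis; a literal narrow root box
discharges it by one lemma (as `mem_rootQ` does for the record quarter box). [folklore chaining] -/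
theorem hcpDichW_of_semOKHQ_box {ρU ρξ m : ℝ} {μ : ℤ} (hρU : ρU ≤ 1 / 4) (hρξ : ρξ ≤ 1 / 4) {cR wR : (Fin 3 × Fin 3) ⊕ Fin 3 → ℤ}
    (hbox : ∀ (U : E3 →L[ℝ] E3) (ξ : E3), ‖U - 1‖ ≤ ρU → ‖ξ‖ ≤ ρξ → 0 ≤ (U (EuclideanSpace.single 1 (1 : ℝ))) 0 →
      (U (EuclideanSpace.single 2 (1 : ℝ))) 1 ≤ 0 → ∀ k, |hcpCoord U ξ k - (cR k : ℝ) / SC| ≤ (wR k : ℝ) / SC)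
    (hμ : 2 * (m + (-(7175 / 10000) + 3 / 400)) * SC ≤ μ) (h : semOKHQ μ cR wR = true) :
    ∀ (U : E3 →L[ℝ] E3) (ξ : E3), (∀ v w : E3, inner ℝ (U v) w = inner ℝ v (U w)) → (∀ w : E3, 0 ≤ inner ℝ w (U w)) →
      ‖U - 1‖ ≤ ρU → ‖ξ‖ ≤ ρξ → HcpDich m U ξ :=
  hcpHalfW_of_quotU hρU hρξ fun U ξ hsa hpos hU hξ h01 h12 hb hab =>
    hcpDich_of_hcpLeafGoal hμ (semOKHQ_forall h U ξ hsa hpos (hU.trans hρU) (hξ.trans hρξ) (hbox U ξ hU hξ h01 h12) hb hab)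

/-- The record quarter root box `rootCHQ / rootWHQ` contains every narrow fundamental domain, so its one fact serves every `(ρ_U, ρ_ξ)` family —
CONTAINMENT (nothing typed is lost by narrowing). [formal bookkeeping] -/
theorem hcpDichW_of_semOKHQ_rootQ {ρU ρξ m : ℝ} {μ : ℤ} (hρU : ρU ≤ 1 / 4) (hρξ : ρξ ≤ 1 / 4)
    (hμ : 2 * (m + (-(7175 / 10000) + 3 / 400)) * SC ≤ μ) (h : semOKHQ μ rootCHQ rootWHQ = true) :
    ∀ (U : E3 →L[ℝ] E3) (ξ : E3), (∀ v w : E3, inner ℝ (U v) w = inner ℝ v (U w)) → (∀ w : E3, 0 ≤ inner ℝ w (U w)) →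
      ‖U - 1‖ ≤ ρU → ‖ξ‖ ≤ ρξ → HcpDich m U ξ :=
  hcpDichW_of_semOKHQ_box hρU hρξ (fun _ _ hU hξ h01 h12 => mem_rootQ (hU.trans hρU) (hξ.trans hρξ) h01 h12) hμ h

/-! ## §3. `(H_W)` from the narrow fcc pruned box sums and the narrow hcp half -/

/-- ★★★ **`(H_W)` FROM THE NARROW fcc PRUNED-BOX-SUM HYPOTHESIS (self-adjoint `U`, `‖U − 1‖ ≤ ρ_U`) AND THE NARROW hcp DICHOTOMY** — the hcp
dichotomy `HcpDich m U ξ` IS the body of the hcp hypothesis of `homFloorW_of_prunedBoxSums_selfAdjoint`. [folklore chaining] -/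
theorem homFloorW_of_fccPruned_of_hcpDichW {ρU ρξ m : ℝ} (hρU : ρU ≤ 1 / 4) (hρξ : ρξ ≤ 1 / 4)
    (hfcc : ∀ U : E3 →L[ℝ] E3, (∀ v w : E3, ⟪U v, w⟫ = ⟪v, U w⟫) → (∀ w : E3, 0 ≤ ⟪w, U w⟫) → ‖U - 1‖ ≤ ρU →
      (∀ (M : ℕ) (z : Fin M → E3) (c : Fin M), Function.Injective z →
          Set.range z = {x : E3 | dist x (z c) ≤ 133 / 10 ∧ ∃ a : Fin 3 → ℤ, x = z c + latPt U fccVec a} →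
          TightNearCap (9 / 5) (3 / 2) z c ∨ ExemptNear (9 / 5) ExRec z c ∨ BadNearCap (9 / 5) (3 / 2) z c) ∨
      m ≤ (∑ b ∈ (Fintype.piFinset fun _ : Fin 3 => Finset.Icc (-7 : ℤ) 7).filter (fun b => b ≠ 0),
        effPot w₄₅ ω₄ (3 / 400) ‖latPt U fccVec b‖) / 2 - (-(7175 / 10000) + 3 / 400))
    (hhcp : ∀ (U : E3 →L[ℝ] E3) (ξ : E3), (∀ v w : E3, inner ℝ (U v) w = inner ℝ v (U w)) → (∀ w : E3, 0 ≤ inner ℝ w (U w)) →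
      ‖U - 1‖ ≤ ρU → ‖ξ‖ ≤ ρξ → HcpDich m U ξ) :
    HomFloorW ρU ρξ m :=
  homFloorW_of_prunedBoxSums_selfAdjoint hρU hρξ hfcc fun U ξ hsa hpos hU hξ => hhcp U ξ hsa hpos hU hξ

/-- ★★★ **`(H_W)` FROM THE NARROW fcc PRUNED-BOX-SUM HYPOTHESIS AND ONE `semOKHQ` FACT on a box containing the narrow fundamental domain** (§2). [folklore] -/
theorem homFloorW_of_fccPruned_semOKHQ_box {ρU ρξ m : ℝ} {μ : ℤ} (hρU : ρU ≤ 1 / 4) (hρξ : ρξ ≤ 1 / 4)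
    (hfcc : ∀ U : E3 →L[ℝ] E3, (∀ v w : E3, ⟪U v, w⟫ = ⟪v, U w⟫) → (∀ w : E3, 0 ≤ ⟪w, U w⟫) → ‖U - 1‖ ≤ ρU →
      (∀ (M : ℕ) (z : Fin M → E3) (c : Fin M), Function.Injective z →
          Set.range z = {x : E3 | dist x (z c) ≤ 133 / 10 ∧ ∃ a : Fin 3 → ℤ, x = z c + latPt U fccVec a} →
          TightNearCap (9 / 5) (3 / 2) z c ∨ ExemptNear (9 / 5) ExRec z c ∨ BadNearCap (9 / 5) (3 / 2) z c) ∨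
      m ≤ (∑ b ∈ (Fintype.piFinset fun _ : Fin 3 => Finset.Icc (-7 : ℤ) 7).filter (fun b => b ≠ 0),
        effPot w₄₅ ω₄ (3 / 400) ‖latPt U fccVec b‖) / 2 - (-(7175 / 10000) + 3 / 400))
    {cR wR : (Fin 3 × Fin 3) ⊕ Fin 3 → ℤ}
    (hbox : ∀ (U : E3 →L[ℝ] E3) (ξ : E3), ‖U - 1‖ ≤ ρU → ‖ξ‖ ≤ ρξ → 0 ≤ (U (EuclideanSpace.single 1 (1 : ℝ))) 0 →
      (U (EuclideanSpace.single 2 (1 : ℝ))) 1 ≤ 0 → ∀ k, |hcpCoord U ξ k - (cR k : ℝ) / SC| ≤ (wR k : ℝ) / SC)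
    (hμ : 2 * (m + (-(7175 / 10000) + 3 / 400)) * SC ≤ μ) (hH : semOKHQ μ cR wR = true) : HomFloorW ρU ρξ m :=
  homFloorW_of_fccPruned_of_hcpDichW hρU hρξ hfcc (hcpDichW_of_semOKHQ_box hρU hρξ hbox hμ hH)

end Summit.AtomisticToContinuum.Crystallization.Theorems.FrustratedLawDichotomyStrainedPatchHomSplitNarrow

end
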